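import Literature.MathematicalPhysics.QuantumFieldTheory.OSSkeletonAnalyticity
import Literature.MathematicalPhysics.QuantumFieldTheory.OSPositivityEuclid
import Literature.MathematicalPhysics.QuantumFieldTheory.OSLaplaceRaw
import Literature.Analysis.InnerProduct.IntegralInnerFactorisation
import HarnessLib

/-!
# The slots of the skeleton functional as matrix elements of superposed vectors (OS II, Ch. V–VI)

Topic `Literature/MathematicalPhysics/QuantumFieldTheory`; sequel of `OSSkeletonAnalyticity`.
Osterwalder–Schrader II (Comm. Math. Phys. 42 (1975)), (5.4) and Ch. VI.1: the `i`-th slot of the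
functional `T` is a *single* matrix element `(Ψ₁, e^{-τH} Ψ₂)` of two vectors obtained by
superposing the left generators over the gaps *left* of `i` and the right generators over the gaps
*right* of `i` — the form in which Ch. VI.1 estimates it through `‖Ψ₁‖ ‖Ψ₂‖`. This file provides:

* the other gaps are assembled from (left gaps, right gaps) by `Fin.append` and integrals split
  by the tree's `integral_finAppend` (`OSPositivityEuclid`);
* `baseVec_apply_of_lt/gt`, `gapTimes_sub_eq_sum` and the **dependence lemmas**
  `leftGen_congr_left`, `rightGen_congr_right`: the left generator of the slot `i` only depends on
  the gaps left of `i`, the right generator only on the gaps right of `i`;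
* `slotInt_eq_inner_superposed` — **the factorised slot**:
  `Qᵢ(τ) = ⟪V_L, e^{-τH} V_R⟫` with `V_L = ∫ conj(W_L(u_L)) v(P(u_L)) du_L`,
  `V_R = ∫ W_R(u_R) v(R(u_R)) du_R` (Bochner integrals in the OS Hilbert space; by
  `Literature.Analysis.InnerProduct.integral_prod_inner_eq_inner_integral_smul`).

## References

* K. Osterwalder, R. Schrader, *Axioms for Euclidean Green's functions II*, Comm. Math. Phys.
  42 (1975) 281–305, Ch. V eq. (5.4), Ch. VI.1. [OsterwalderSchraderCMP1975]
-/

noncomputable section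

open MeasureTheory Set Filter
open _root_.Topology
open scoped InnerProductSpace NNReal ComplexConjugate SchwartzMap

namespace Literature.MathematicalPhysics.QuantumFieldTheory

/-! ### Dependence of the generators on the left and right gaps only -/

section Dependence

variable {d : ℕ} [NeZero d] {k : ℕ} {i : Fin (k + 1)} {w' : ℝ}

omit [NeZero d] in
/-- Skeleton times only see the gaps before the point. [folklore] -/
theorem gapTimes_congr {t₁ t₂ : Fin (k + 1) → ℝ} {J : Fin (k + 2)}
    (h : ∀ i' : Fin (k + 1), i'.val < J.val → t₁ i' = t₂ i') : gapTimes t₁ J = gapTimes t₂ J := by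
  unfold gapTimes
  exact Finset.sum_congr rfl fun i' hi' => h i' (Finset.mem_filter.1 hi').2

omit [NeZero d] in
/-- Differences of skeleton times are sums of the gaps in between. [folklore] -/
theorem gapTimes_sub_eq_sum (t : Fin (k + 1) → ℝ) {J₀ J : Fin (k + 2)} (h : J₀.val ≤ J.val) :
    gapTimes t J - gapTimes t J₀ =
      ∑ i' ∈ Finset.univ.filter (fun i' : Fin (k + 1) => J₀.val ≤ i'.val ∧ i'.val < J.val), t i' := by
  unfold gapTimes
  have hsub : Finset.univ.filter (fun i' : Fin (k + 1) => i'.val < J₀.val) ⊆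
      Finset.univ.filter (fun i' : Fin (k + 1) => i'.val < J.val) := by
    intro i' hi'
    rw [Finset.mem_filter] at hi' ⊢
    exact ⟨hi'.1, by omega⟩
  rw [← Finset.sum_sdiff hsub, add_sub_cancel_right]
  refine Finset.sum_congr ?_ fun _ _ => rfl
  ext i'
  simp only [Finset.mem_sdiff, Finset.mem_filter, Finset.mem_univ, true_and, not_lt]
  tauto

omit [NeZero d] in
/-- **Recentred times of left points only see the left gaps.** [folklore] -/
theorem shTimes_congr_left {t₁ t₂ : Fin (k + 1) → ℝ} {J : Fin (k + 2)} (hJ : J.val ≤ i.val)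
    (h : ∀ i' : Fin (k + 1), i'.val < i.val → t₁ i' = t₂ i') : shTimes i w' t₁ J = shTimes i w' t₂ J := by
  unfold shTimes
  rw [gapTimes_congr (J := J) fun i' hi' => h i' (by omega),
    gapTimes_congr (J := i.castSucc) fun i' hi' => h i' (by simpa using hi')]

omit [NeZero d] in
/-- **Recentred times of right points only see the right gaps** (including the gap `i`). [folklore] -/
theorem shTimes_congr_right {t₁ t₂ : Fin (k + 1) → ℝ} {J : Fin (k + 2)} (hJ : i.val < J.val)
    (h : ∀ i' : Fin (k + 1), i.val ≤ i'.val → t₁ i' = t₂ i') : shTimes i w' t₁ J = shTimes i w' t₂ J := by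
  unfold shTimes
  have hle : (i.castSucc : Fin (k + 2)).val ≤ J.val := by simp; omega
  have e1 := gapTimes_sub_eq_sum t₁ hle
  have e2 := gapTimes_sub_eq_sum t₂ hle
  have hs : ∑ i' ∈ Finset.univ.filter (fun i' : Fin (k + 1) => (i.castSucc : Fin (k + 2)).val ≤ i'.val ∧ i'.val < J.val), t₁ i' =
      ∑ i' ∈ Finset.univ.filter (fun i' : Fin (k + 1) => (i.castSucc : Fin (k + 2)).val ≤ i'.val ∧ i'.val < J.val), t₂ i' :=
    Finset.sum_congr rfl fun i' hi' => h i' (by have := (Finset.mem_filter.1 hi').2.1; simpa using this)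
  linarith

omit [NeZero d] in
/-- The base gap vector left of the slot: `baseVec i w' t i' = |t (castPred i')|` for `i' < i`. [folklore] -/
theorem baseVec_apply_of_lt (t : Fin k → ℝ) {i' : Fin (k + 1)} (hi' : i' < i) :
    baseVec i w' t i' = |t (i'.castPred (Fin.ne_last_of_lt hi'))| := by
  have h := Fin.insertNth_apply_succAbove (α := fun _ => ℝ) i w' (fun j => |t j|) (i'.castPred (Fin.ne_last_of_lt hi'))
  rw [Fin.succAbove_castPred_of_lt i i' hi'] at h
  exact h

omit [NeZero d] in
/-- The base gap vector right of the slot: `baseVec i w' t i' = |t (pred i')|` for `i < i'`. [folklore] -/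
theorem baseVec_apply_of_gt (t : Fin k → ℝ) {i' : Fin (k + 1)} (hi' : i < i') :
    baseVec i w' t i' = |t (i'.pred (Fin.ne_zero_of_lt hi'))| := by
  have h := Fin.insertNth_apply_succAbove (α := fun _ => ℝ) i w' (fun j => |t j|) (i'.pred (Fin.ne_zero_of_lt hi'))
  rw [Fin.succAbove_pred_of_lt i i' hi'] at h
  exact h

omit [NeZero d] in
/-- Base gap vectors agree left of the slot when the gaps agree there. [folklore] -/
theorem baseVec_congr_left {t₁ t₂ : Fin k → ℝ} (h : ∀ j : Fin k, j.val < i.val → t₁ j = t₂ j)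
    (i' : Fin (k + 1)) (hi' : i'.val < i.val) : baseVec i w' t₁ i' = baseVec i w' t₂ i' := by
  have hlt : i' < i := Fin.lt_def.2 hi'
  rw [baseVec_apply_of_lt t₁ hlt, baseVec_apply_of_lt t₂ hlt, h _ (by simpa using hi')]

omit [NeZero d] in
/-- Base gap vectors agree at and right of the slot when the gaps agree right of it. [folklore] -/
theorem baseVec_congr_right {t₁ t₂ : Fin k → ℝ} (h : ∀ j : Fin k, i.val ≤ j.val → t₁ j = t₂ j)
    (i' : Fin (k + 1)) (hi' : i.val ≤ i'.val) : baseVec i w' t₁ i' = baseVec i w' t₂ i' := by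
  rcases eq_or_lt_of_le hi' with heq | hlt
  · have : i' = i := (Fin.ext heq).symm
    subst this
    rw [baseVec_apply_same, baseVec_apply_same]
  · have hlt' : i < i' := Fin.lt_def.2 hlt
    rw [baseVec_apply_of_gt t₁ hlt', baseVec_apply_of_gt t₂ hlt', h _ ?_]
    simp only [Fin.val_pred]
    omega

variable (φ : Fin (k + 2) → 𝓢(EuclideanSpace ℝ (Fin d), ℂ)) (i) (w')

/-- **The left generator of the slot `i` only depends on the gaps left of `i`.** [folklore] -/
theorem leftGen_congr_left {t₁ t₂ : Fin k → ℝ} (h : ∀ j : Fin k, j.val < i.val → t₁ j = t₂ j) :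
    leftGen φ i w' t₁ = leftGen φ i w' t₂ := by
  unfold leftGen leftGenFn
  congr 2
  funext J
  exact shTimes_congr_left (val_cast_castAdd_le (i := i) J) (fun i' hi' => baseVec_congr_left h i' hi')

/-- **The right generator of the slot `i` only depends on the gaps right of `i`.** [folklore] -/
theorem rightGen_congr_right {t₁ t₂ : Fin k → ℝ} (h : ∀ j : Fin k, i.val ≤ j.val → t₁ j = t₂ j) :
    rightGen φ i w' t₁ = rightGen φ i w' t₂ := by
  unfold rightGen rightGenFn
  congr 1
  funext J
  beta_reduce
  rw [shTimes_congr_right (lt_val_cast_natAdd (i := i) J) (fun i' hi' => baseVec_congr_right h i' hi')]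

end Dependence

/-! ### The factorised slot -/

section Factorised

variable {d : ℕ} [NeZero d]

open Literature.MathematicalPhysics.QuantumLattice (SchwingerFamily IsPositiveTimeMulti)
open Literature.MathematicalPhysics.QuantumLattice.SchwingerFamily
open Literature.MathematicalPhysics.QuantumLattice.SchwingerFamily.OSSpace

variable (𝔖 : SchwingerFamily (EuclideanSpace ℝ (Fin d))) (hE1 : 𝔖.IsEuclideanCovariant)
  (hE2 : 𝔖.IsOSReflectionPositive) {m n : ℕ} (φ : Fin (m + n + 2) → 𝓢(EuclideanSpace ℝ (Fin d), ℂ))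
  (i : Fin (m + n + 1)) {w' r : ℝ}
  (hφ : ∀ j, tsupport (φ j : EuclideanSpace ℝ (Fin d) → ℂ) ⊆ {y | |y 0| ≤ r}) (hw : 2 * r < w')
  (hw0 : 0 ≤ w') (b : ℝ)

/-- **The left vector field** `u_L ↦ v(Pᵢ(w' + (u_L, 0)))`. [folklore] -/
def leftVec (uL : Fin m → ℝ) : OSHilbert 𝔖 hE2 :=
  ι 𝔖 hE2 (δ 𝔖 hE2 (mkGen (leftGen φ i w' (fun j => w' + Fin.append uL (0 : Fin n → ℝ) j))
    (isPositiveTimeMulti_leftGen hφ hw hw0 _)))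

/-- **The right vector field** `u_R ↦ v(Rᵢ(w' + (0, u_R)))`. [folklore] -/
def rightVec (uR : Fin n → ℝ) : OSHilbert 𝔖 hE2 :=
  ι 𝔖 hE2 (δ 𝔖 hE2 (mkGen (rightGen φ i w' (fun j => w' + Fin.append (0 : Fin m → ℝ) uR j))
    (isPositiveTimeMulti_rightGen hφ hw hw0 _)))

/-- The left weight `∏_{a} logW b θ_{σᵢ(castAdd a)} (u_L a)`. [folklore] -/
def leftWeight (θ : Fin (m + n + 1) → ℝ → ℂ) (uL : Fin m → ℝ) : ℂ :=
  ∏ a, logW b (θ (i.succAbove (Fin.castAdd n a))) (uL a)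

/-- The right weight `∏_{b} logW b θ_{σᵢ(natAdd b)} (u_R b)`. [folklore] -/
def rightWeight (θ : Fin (m + n + 1) → ℝ → ℂ) (uR : Fin n → ℝ) : ℂ :=
  ∏ c, logW b (θ (i.succAbove (Fin.natAdd m c))) (uR c)

variable {𝔖 hE1 hE2 φ i b}

omit [NeZero d] in
/-- Appended gaps with the same left part agree left of the slot. [folklore] -/
theorem append_congr_left (hi : i.val = m) (uL : Fin m → ℝ) (uR uR' : Fin n → ℝ) (j : Fin (m + n)) (hj : j.val < i.val) :
    Fin.append uL uR j = Fin.append uL uR' j := by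
  have hjm : j.val < m := lt_of_lt_of_eq hj hi
  have : j = Fin.castAdd n ⟨j.val, hjm⟩ := Fin.ext rfl
  rw [this, Fin.append_left, Fin.append_left]

omit [NeZero d] in
/-- Appended gaps with the same right part agree right of the slot. [folklore] -/
theorem append_congr_right (hi : i.val = m) (uL uL' : Fin m → ℝ) (uR : Fin n → ℝ) (j : Fin (m + n)) (hj : i.val ≤ j.val) :
    Fin.append uL uR j = Fin.append uL' uR j := by
  have hjm : m ≤ j.val := by omega
  have hlt : j.val - m < n := by omega
  have : j = Fin.natAdd m ⟨j.val - m, hlt⟩ := Fin.ext (by simp; omega)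
  rw [this, Fin.append_right, Fin.append_right]

omit [NeZero d] in
/-- `1 + ‖w' + (u_L ⧺ u_R)‖ ≤ (1 + |w'|)(1 + max ‖u_L‖ ‖u_R‖)`. [folklore] -/
theorem one_add_norm_const_add_append_le (w' : ℝ) (uL : Fin m → ℝ) (uR : Fin n → ℝ) :
    1 + ‖fun j => w' + Fin.append uL uR j‖ ≤ (1 + |w'|) * (1 + max ‖uL‖ ‖uR‖) :=
  (one_add_norm_const_add_le w' (Fin.append uL uR)).trans (by
    gcongr; exact norm_append_le uL uR)

/-- Changing the generators propositionally does not change `gapContinuation`. [folklore] -/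
theorem gapContinuation_congr {nP nQ : ℕ} {F F' : 𝓢((Fin nP → EuclideanSpace ℝ (Fin d)), ℂ)} (hFF' : F = F')
    (hF : IsPositiveTimeMulti F) (hF' : IsPositiveTimeMulti F') {G G' : 𝓢((Fin nQ → EuclideanSpace ℝ (Fin d)), ℂ)}
    (hGG' : G = G') (hG : IsPositiveTimeMulti G) (hG' : IsPositiveTimeMulti G') (τ : ℂ) :
    gapContinuation 𝔖 hE1 hE2 (mkGen F hF) (mkGen G hG) τ = gapContinuation 𝔖 hE1 hE2 (mkGen F' hF') (mkGen G' hG') τ := by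
  subst hFF' hGG'; rfl

/-- **The slot function at appended gaps is a matrix element of the left and right vectors.** [folklore] -/
theorem slotExt_append (hi : i.val = m) (z : (Fin m → ℝ) × (Fin n → ℝ)) (τ : ℂ) :
    slotExt 𝔖 hE1 hE2 φ i hφ hw hw0 (fun j => w' + Fin.append z.1 z.2 j) τ =
      ⟪leftVec 𝔖 hE2 φ i hφ hw hw0 z.1, holoShiftH (hE2 := hE2) hE1 τ (rightVec 𝔖 hE2 φ i hφ hw hw0 z.2)⟫_ℂ := by
  rw [slotExt, leftVec, rightVec]
  have hL : leftGen φ i w' (fun j => w' + Fin.append z.1 z.2 j) = leftGen φ i w' (fun j => w' + Fin.append z.1 (0 : Fin n → ℝ) j) :=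
    leftGen_congr_left (φ := φ) (i := i) (w' := w') fun j hj => by rw [append_congr_left (i := i) hi z.1 z.2 0 j hj]
  have hR : rightGen φ i w' (fun j => w' + Fin.append z.1 z.2 j) = rightGen φ i w' (fun j => w' + Fin.append (0 : Fin m → ℝ) z.2 j) :=
    rightGen_congr_right (φ := φ) (i := i) (w' := w') fun j hj => by rw [append_congr_right (i := i) hi z.1 0 z.2 j hj]
  rw [gapContinuation_congr (hE1 := hE1) (hE2 := hE2) hL _ (isPositiveTimeMulti_leftGen hφ hw hw0 _) hR _
    (isPositiveTimeMulti_rightGen hφ hw hw0 _) τ]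
  rfl

/-- The product weight over all other gaps splits into left and right weights. [folklore] -/
theorem prod_logW_append (θ : Fin (m + n + 1) → ℝ → ℂ) (z : (Fin m → ℝ) × (Fin n → ℝ)) :
    ∏ j, logW b (θ (i.succAbove j)) (Fin.append z.1 z.2 j) = leftWeight i b θ z.1 * rightWeight i b θ z.2 := by
  rw [Fin.prod_univ_add, leftWeight, rightWeight]
  simp only [Fin.append_left, Fin.append_right]

/-- **The factorised slot** (OS II (5.4) in the form used in Ch. VI.1): for Schwartz profiles,
`Qᵢ(τ) = ⟪∫ conj(W_L) • v(P), e^{-τH} (∫ W_R • v(R))⟫` — the integrated slot function is a single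
matrix element of the superposed left and right vectors. [cite: OsterwalderSchraderCMP1975, Ch. V eq. (5.4), Ch. VI.1] -/
theorem slotInt_eq_inner_superposed (hi : i.val = m) (hb : 0 < b) (θ : Fin (m + n + 1) → 𝓢(ℝ, ℂ)) (τ : ℂ) :
    slotInt 𝔖 hE1 hE2 φ i hφ hw hw0 b (fun j => ⇑(θ j)) τ =
      ⟪∫ uL, conj (leftWeight i b (fun j => ⇑(θ j)) uL) • leftVec 𝔖 hE2 φ i hφ hw hw0 uL,
        holoShiftH (hE2 := hE2) hE1 τ (∫ uR, rightWeight i b (fun j => ⇑(θ j)) uR • rightVec 𝔖 hE2 φ i hφ hw hw0 uR)⟫_ℂ := by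
  rw [slotInt, integral_finAppend m n]
  have hfun : (fun z : (Fin m → ℝ) × (Fin n → ℝ) =>
      (∏ j, logW b (θ (i.succAbove j)) (Fin.append z.1 z.2 j)) *
        slotExt 𝔖 hE1 hE2 φ i hφ hw hw0 (fun j => w' + Fin.append z.1 z.2 j) τ) =
      fun z => (conj (conj (leftWeight i b (fun j => ⇑(θ j)) z.1)) * rightWeight i b (fun j => ⇑(θ j)) z.2) *
        ⟪leftVec 𝔖 hE2 φ i hφ hw hw0 z.1, holoShiftH (hE2 := hE2) hE1 τ (rightVec 𝔖 hE2 φ i hφ hw hw0 z.2)⟫_ℂ := by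
    funext z
    rw [Complex.conj_conj, ← prod_logW_append, ← slotExt_append (hφ := hφ) (hw := hw) (hw0 := hw0) hi]
  rw [hfun]
  -- hypotheses of the abstract factorisation
  obtain ⟨CL, NL, hCL0, hCL⟩ := exists_norm_δ_leftGen_le φ i w' 𝔖 hE2
  obtain ⟨CR, NR, hCR0, hCR⟩ := exists_norm_δ_rightGen_le φ i w' 𝔖 hE2
  have hVL : ∀ uL, ‖leftVec 𝔖 hE2 φ i hφ hw hw0 uL‖ ≤ CL * (1 + |w'|) ^ NL * (1 + ‖uL‖) ^ NL := fun uL => by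
    rw [leftVec, LinearIsometry.norm_map]
    refine (hCL _ _).trans ?_
    rw [mul_assoc, ← mul_pow]
    gcongr
    exact (one_add_norm_const_add_append_le w' uL 0).trans (by gcongr; simp)
  have hVR : ∀ uR, ‖rightVec 𝔖 hE2 φ i hφ hw hw0 uR‖ ≤ CR * (1 + |w'|) ^ NR * (1 + ‖uR‖) ^ NR := fun uR => by
    rw [rightVec, LinearIsometry.norm_map]
    refine (hCR _ _).trans ?_
    rw [mul_assoc, ← mul_pow]
    gcongr
    exact (one_add_norm_const_add_append_le w' 0 uR).trans (by gcongr; simp)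
  have hcontL : Continuous (leftVec 𝔖 hE2 φ i hφ hw hw0) :=
    continuous_ι_δ_mkGen hE2 ((continuous_leftGen φ i w').comp (continuous_pi fun j =>
      continuous_const.add ((continuous_apply j).comp ((continuous_finAppend (E := ℝ)).comp
        (continuous_id.prodMk continuous_const))))) _
  have hcontR : Continuous (rightVec 𝔖 hE2 φ i hφ hw hw0) :=
    continuous_ι_δ_mkGen hE2 ((continuous_rightGen φ i w').comp (continuous_pi fun j =>
      continuous_const.add ((continuous_apply j).comp ((continuous_finAppend (E := ℝ)).comp
        (continuous_const.prodMk continuous_id))))) _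
  have hmeasWL : Measurable (leftWeight i b fun j => ⇑(θ j)) :=
    Finset.measurable_prod _ fun a _ => (measurable_logW (θ _).continuous).comp (measurable_pi_apply a)
  have hmeasWR : Measurable (rightWeight i b fun j => ⇑(θ j)) :=
    Finset.measurable_prod _ fun c _ => (measurable_logW (θ _).continuous).comp (measurable_pi_apply c)
  -- integrability of `‖W‖ ‖V‖`
  have hintL : Integrable fun uL : Fin m → ℝ =>
      ‖conj (leftWeight i b (fun j => ⇑(θ j)) uL)‖ * ‖leftVec 𝔖 hE2 φ i hφ hw hw0 uL‖ := by
    have h := (integrable_prod_logW_mul hb (fun a => θ (i.succAbove (Fin.castAdd n a)))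
      (G := fun uL : Fin m → ℝ => ((CL * (1 + |w'|) ^ NL * (1 + ‖uL‖) ^ NL : ℝ) : ℂ))
      (by fun_prop) (C := CL * (1 + |w'|) ^ NL) (N := NL)
      (fun uL => by rw [Complex.norm_real, Real.norm_eq_abs, abs_of_nonneg (by positivity)])).norm
    refine h.mono' ((Complex.continuous_conj.measurable.comp hmeasWL).norm.aestronglyMeasurable.mul
      hcontL.norm.aestronglyMeasurable) (Eventually.of_forall fun uL => ?_)
    rw [Real.norm_eq_abs, abs_of_nonneg (by positivity), Complex.norm_conj, norm_mul, Complex.norm_real,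
      Real.norm_eq_abs, abs_of_nonneg (by positivity)]
    exact mul_le_mul_of_nonneg_left (hVL uL) (norm_nonneg _)
  have hintR : Integrable fun uR : Fin n → ℝ =>
      ‖rightWeight i b (fun j => ⇑(θ j)) uR‖ * ‖rightVec 𝔖 hE2 φ i hφ hw hw0 uR‖ := by
    have h := (integrable_prod_logW_mul hb (fun c => θ (i.succAbove (Fin.natAdd m c)))
      (G := fun uR : Fin n → ℝ => ((CR * (1 + |w'|) ^ NR * (1 + ‖uR‖) ^ NR : ℝ) : ℂ))
      (by fun_prop) (C := CR * (1 + |w'|) ^ NR) (N := NR)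
      (fun uR => by rw [Complex.norm_real, Real.norm_eq_abs, abs_of_nonneg (by positivity)])).norm
    refine h.mono' (hmeasWR.norm.aestronglyMeasurable.mul hcontR.norm.aestronglyMeasurable)
      (Eventually.of_forall fun uR => ?_)
    rw [Real.norm_eq_abs, abs_of_nonneg (by positivity), norm_mul, Complex.norm_real,
      Real.norm_eq_abs, abs_of_nonneg (by positivity)]
    exact mul_le_mul_of_nonneg_left (hVR uR) (norm_nonneg _)
  have key := Literature.Analysis.InnerProduct.integral_prod_inner_eq_inner_integral_smul
    (μ := (volume : Measure (Fin m → ℝ))) (ν := (volume : Measure (Fin n → ℝ)))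
    (holoShiftH (hE2 := hE2) hE1 τ)
    (gL := fun uL => conj (leftWeight i b (fun j => ⇑(θ j)) uL)) (VL := leftVec 𝔖 hE2 φ i hφ hw hw0)
    (gR := rightWeight i b fun j => ⇑(θ j)) (VR := rightVec 𝔖 hE2 φ i hφ hw hw0)
    (Complex.continuous_conj.measurable.comp hmeasWL).aestronglyMeasurable hcontL.aestronglyMeasurable
    hmeasWR.aestronglyMeasurable hcontR.aestronglyMeasurable hintL hintR
  exact key

end Factorised

end Literature.MathematicalPhysics.QuantumFieldTheory
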